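import Summits.ResolutionOfSingularities.ResolutionOfSingularities.Theorems.HilbertSamuelEliminationSigmaMaxModificationsStubCentreSeqPackage
import Summits.ResolutionOfSingularities.ResolutionOfSingularities.Theorems.SigmaMaxModifications.Negative.Levels
import Literature.AlgebraicGeometry.Resolution.QuasiExcellentSchemes
import Literature.AlgebraicGeometry.Resolution.ExcellentRingsFieldProofs
import Literature.AlgebraicGeometry.Resolution.HilbertSamuelLowerBound
import Mathlib.AlgebraicGeometry.Morphisms.Proper
import Mathlib.AlgebraicGeometry.Noetherian
import HarnessLib

/-!
# `SigmaMaxModifications` (crux stmt-ResolutionOfSingularities-18506, line `Sketch`):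
# stub `stub_nuMods_surface_of_nuFact` — `ν`-modifications of surfaces at every level `N ≥ 2`
# from the printed `ν`-eliminations at level `2`

Stub `stub_nuMods_surface_of_nuFact` of the lead skeleton `Sketch` (reshape 2) for the crux
`Summit.ResolutionOfSingularities.ResolutionOfSingularities.Theses.HilbertSamuelElimination.SigmaMaxModifications`.

The antecedent is Cossart–Jannsen–Saito, LNM 2270, Thm. 6.28 with Thm. 3.10 (1) in the tree's
vocabulary: for every reduced excellent Noetherian `X` of dimension `≤ 2` and every maximal
value `ν ≠ Φ^{(2)}` of `Σ_X(2)` a finite sequence of blow-ups `s : CentreSeq X` with centres over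
the stratum `X(ν)`, along whose composite `H^2` does not increase, after which `ν` is no longer
a value (the data of a `ν`-elimination, CJS Def. 6.14). The conclusion is the input `hmod` of
the graded glue at `d = 2`: for `Y/k` reduced, separated, of finite type with `dim Y ≤ 2`,
`dim Y ≤ N`, `2 ≤ N` and a maximal value `ν ≠ Φ^{(N)}` of `Σ_Y(N)`, a `ν`-MODIFICATION at level
`N` — a proper `π : Y' → Y` with `Y'` reduced of dimension `≤ 2` and `≤ N`, an isomorphism over
every open inside `Y ∖ Y(ν)` with dense preimages of dense such opens, `H^N` non-increasing,
and `ν ∉ Σ_{Y'}(N)`.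

Proof. `Y` is Noetherian (`Scheme.isNoetherian_of_finiteType_over_field`) and excellent
(`Scheme.isExcellent_of_locallyOfFiniteType Stacks07QW_field_holds`). For the FIXED scheme `Y`
the `ν`-elimination data move up one level `M ↦ M + 1` as soon as `dim Y ≤ M`
(`nuEliminationAt_succ`, the pointwise form of the landed `nuEliminationsExist_succ`, CJS
Rem. 2.29 (b)): `ψ_Y ≤ dim Y ≤ M` (`Negative.hsPsi_le_of_dim_le`), so
`H^{M+1}_Y = (H^M_Y)^{(1)}` pointwise (`Negative.hsFun_succ`); a maximal `ν' ≠ Φ^{(M+1)}` at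
level `M + 1` is `ν^{(1)}` for the maximal `ν = H^M_Y(x) ≠ Φ^{(M)}`
(`Negative.maximal_of_maximal_psum_succ`, `iterPSum_succ`) with the same stratum
(`Negative.hsStratum_succ_psum`); monotonicity moves up by `Negative.hsFun_succ_le_of_le`
(`dim s.top ≤ M`, `topologicalKrullDim_top_le`) and the killing by
`Negative.psum_not_mem_hsValues_succ`. Induction from level `2` (`Nat.le_induction`) gives the
data at level `N`, and `stub_centreSeq_package` packages `s.comp : s.top → Y` (proper, `s.top`
reduced of dimension `≤ 2`, isomorphism over opens inside `Y ∖ Y(ν)`, dense preimages);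
`dim s.top ≤ N` is `topologicalKrullDim_top_le` again.

## Sources

* V. Cossart, U. Jannsen, S. Saito, *Desingularization: Invariants and Strategy — Application
  to Dimension 2*, LNM 2270 (2020), Def. 2.28, Rem. 2.29 (b), Def. 6.14, Thm. 6.28.
  [CossartJannsenSaito2020]
-/

set_option linter.dupNamespace false -- mandated namespace of this single-conjunct summit

noncomputable section

open CategoryTheory AlgebraicGeometry TopologicalSpace
open Literature.AlgebraicGeometry.Resolution Literature.RingTheory.HilbertSamuel

namespace Summit.ResolutionOfSingularities.ResolutionOfSingularities.Theorems.SigmaMaxModifications.Sketch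

/-- **Level raising `M ↦ M + 1` of `ν`-elimination data on a FIXED scheme** (pointwise form of
`nuEliminationsExist_succ`). For a locally Noetherian `Y` with `dim Y ≤ M`: if every maximal
value `ν ≠ Φ^{(M)}` of `Σ_Y(M)` has a blow-up sequence with centres over `Y(ν)` along which
`H^M` does not increase and after which `ν` is no longer a value, then the same holds at level
`M + 1`. Since `ψ_Y ≤ dim Y ≤ M`, `H^{M+1}_Y = (H^M_Y)^{(1)}` pointwise, `ν ↦ ν^{(1)}` is
monotone and injective, so a maximal `ν' ≠ Φ^{(M+1)}` is `ν^{(1)}` for a maximal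
`ν ≠ Φ^{(M)}` with `Y(ν') = Y(ν)`, and the level-`M` sequence for `ν` works at level `M + 1`
(`dim s.top ≤ M`). [cite: CossartJannsenSaito2020, Rem. 2.29 (b), Def. 6.14] -/
theorem nuEliminationAt_succ {Y : Scheme.{0}} [IsLocallyNoetherian Y] {M : ℕ}
    (hdim : topologicalKrullDim Y ≤ (M : WithBot ℕ∞))
    (H : ∀ ν : ℕ → ℕ, Maximal (· ∈ Scheme.hsValues Y M) ν → ν ≠ iterPSum M Phi →
      ∃ s : CentreSeq Y, s.CentresOver (Scheme.hsStratum Y M ν) ∧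
        (∀ x' : s.top, Scheme.hsFun s.top M x' ≤ Scheme.hsFun Y M (s.comp.base x')) ∧
        ν ∉ Scheme.hsValues s.top M) :
    ∀ ν : ℕ → ℕ, Maximal (· ∈ Scheme.hsValues Y (M + 1)) ν → ν ≠ iterPSum (M + 1) Phi →
      ∃ s : CentreSeq Y, s.CentresOver (Scheme.hsStratum Y (M + 1) ν) ∧
        (∀ x' : s.top,
          Scheme.hsFun s.top (M + 1) x' ≤ Scheme.hsFun Y (M + 1) (s.comp.base x')) ∧
        ν ∉ Scheme.hsValues s.top (M + 1) := by
  intro ν' hν' hν'Φ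
  -- `ψ_Y ≤ M` everywhere, so `H^{M+1}_Y = (H^M_Y)^{(1)}` pointwise
  have hψ : ∀ y : Y, Scheme.hsPsi Y y ≤ M := Negative.hsPsi_le_of_dim_le hdim
  -- `ν' = H^{M+1}_Y(x) = (H^M_Y(x))^{(1)}` for a point `x` of the (non-empty) stratum `Y(ν')`
  obtain ⟨x, rfl⟩ := hν'.1
  rw [Negative.hsFun_succ x (hψ x)] at hν' hν'Φ ⊢
  -- the level-`M` value `ν = H^M_Y(x)` is maximal and `≠ Φ^{(M)}`
  have hν : Maximal (· ∈ Scheme.hsValues Y M) (Scheme.hsFun Y M x) :=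
    Negative.maximal_of_maximal_psum_succ hdim ⟨x, rfl⟩ hν'
  have hνΦ : Scheme.hsFun Y M x ≠ iterPSum M Phi := fun h => hν'Φ (by rw [h, iterPSum_succ])
  -- the level-`M` elimination of `ν`, read at level `M + 1`
  obtain ⟨s, hover, hmono, hkill⟩ := H _ hν hνΦ
  haveI : IsProper s.comp := s.isProper_comp
  haveI : IsLocallyNoetherian s.top := LocallyOfFiniteType.isLocallyNoetherian s.comp
  have hdim' : topologicalKrullDim s.top ≤ (M : WithBot ℕ∞) := topologicalKrullDim_top_le s hdim
  have hψ' : ∀ x' : s.top, Scheme.hsPsi s.top x' ≤ M := Negative.hsPsi_le_of_dim_le hdim'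
  refine ⟨s, ?_, fun x' => Negative.hsFun_succ_le_of_le (hψ _) (hψ' x') (hmono x'),
    Negative.psum_not_mem_hsValues_succ hdim' hkill⟩
  rwa [Negative.hsStratum_succ_psum hdim]

/-- **`ν`-elimination data of a surface at every level `N ≥ 2`, from level `2`.** For a locally
Noetherian `Y` with `dim Y ≤ 2`: the level-`2` `ν`-elimination data (for all maximal
`ν ≠ Φ^{(2)}`) give the level-`N` data for every `N ≥ 2`, by induction on `N` with
`nuEliminationAt_succ` (`dim Y ≤ 2 ≤ M` at each step). [cite: CossartJannsenSaito2020, Rem. 2.29 (b), Def. 6.14] -/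
theorem nuEliminationAt_of_two {Y : Scheme.{0}} [IsLocallyNoetherian Y]
    (hdim2 : topologicalKrullDim Y ≤ ((2 : ℕ) : WithBot ℕ∞))
    (H : ∀ ν : ℕ → ℕ, Maximal (· ∈ Scheme.hsValues Y 2) ν → ν ≠ iterPSum 2 Phi →
      ∃ s : CentreSeq Y, s.CentresOver (Scheme.hsStratum Y 2 ν) ∧
        (∀ x' : s.top, Scheme.hsFun s.top 2 x' ≤ Scheme.hsFun Y 2 (s.comp.base x')) ∧
        ν ∉ Scheme.hsValues s.top 2) :
    ∀ N : ℕ, 2 ≤ N →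
      ∀ ν : ℕ → ℕ, Maximal (· ∈ Scheme.hsValues Y N) ν → ν ≠ iterPSum N Phi →
        ∃ s : CentreSeq Y, s.CentresOver (Scheme.hsStratum Y N ν) ∧
          (∀ x' : s.top, Scheme.hsFun s.top N x' ≤ Scheme.hsFun Y N (s.comp.base x')) ∧
          ν ∉ Scheme.hsValues s.top N := by
  intro N hN
  induction N, hN using Nat.le_induction with
  | base => exact H
  | succ M hM ih => exact nuEliminationAt_succ (hdim2.trans (by exact_mod_cast hM)) ih

/-- **`ν`-modifications of surfaces at every level `N ≥ 2`, from the printed `ν`-eliminations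
at level `2`** (the input of the graded glue at `d = 2`). If every reduced excellent Noetherian
`X` of dimension `≤ 2` admits, for every maximal value `ν ≠ Φ^{(2)}` of `Σ_X(2)`, a blow-up
sequence with centres over `X(ν)` along which `H^2` does not increase and after which `ν` is no
longer a value (CJS Thm. 6.28 with Thm. 3.10 (1), Def. 6.14), then for `Y/k` reduced, separated,
of finite type with `dim Y ≤ 2`, `dim Y ≤ N`, `2 ≤ N`, and a maximal value `ν ≠ Φ^{(N)}` of
`Σ_Y(N)` there is a `ν`-modification at level `N`: proper, reduced source of dimension `≤ 2`
and `≤ N`, an isomorphism over the opens inside `Y ∖ Y(ν)` with dense preimages of dense such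
opens, `H^N` non-increasing, `ν` no longer a value. `Y` is Noetherian and excellent (finite type
over a field, Stacks 07QW); the level-`2` data move up to level `N` ν-wise
(`nuEliminationAt_of_two`: `H^{M+1} = (H^M)^{(1)}` pointwise as `ψ_Y ≤ dim Y ≤ M`, partial
summation monotone and injective, Rem. 2.29 (b)), and the blow-up sequence is packaged by
`stub_centreSeq_package`. [cite: CossartJannsenSaito2020, Rem. 2.29 (b), Def. 6.14] -/
theorem stub_nuMods_surface_of_nuFact :
    (∀ (X : Scheme.{0}) [IsNoetherian X] [IsReduced X], Scheme.IsExcellent X →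
      topologicalKrullDim X ≤ 2 →
      ∀ ν : ℕ → ℕ, Maximal (· ∈ Scheme.hsValues X 2) ν → ν ≠ iterPSum 2 Phi →
        ∃ s : CentreSeq X, s.CentresOver (Scheme.hsStratum X 2 ν) ∧
          (∀ x' : s.top, Scheme.hsFun s.top 2 x' ≤ Scheme.hsFun X 2 (s.comp.base x')) ∧
          ν ∉ Scheme.hsValues s.top 2) →
    ∀ (k : Type) [Field k] (N : ℕ), 2 ≤ N →
      ∀ (Y : Scheme.{0}) (g : Y ⟶ Spec (.of k)), IsSeparated g → LocallyOfFiniteType g →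
        QuasiCompact g → IsReduced Y → topologicalKrullDim Y ≤ ((2 : ℕ) : WithBot ℕ∞) →
        topologicalKrullDim Y ≤ (N : WithBot ℕ∞) →
        ∀ ν : ℕ → ℕ, Maximal (· ∈ Scheme.hsValues Y N) ν → ν ≠ iterPSum N Phi →
          ∃ (Y' : Scheme.{0}) (π : Y' ⟶ Y), IsProper π ∧ IsReduced Y' ∧
            topologicalKrullDim Y' ≤ ((2 : ℕ) : WithBot ℕ∞) ∧
            topologicalKrullDim Y' ≤ (N : WithBot ℕ∞) ∧
            (∀ U : Y.Opens, (U : Set Y) ⊆ (Scheme.hsStratum Y N ν)ᶜ → IsIso (π ∣_ U)) ∧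
            (∀ U : Y.Opens, Dense (U : Set Y) → (U : Set Y) ⊆ (Scheme.hsStratum Y N ν)ᶜ →
              Dense ((π ⁻¹ᵁ U : Y'.Opens) : Set Y')) ∧
            (∀ y' : Y', Scheme.hsFun Y' N y' ≤ Scheme.hsFun Y N (π.base y')) ∧
            ν ∉ Scheme.hsValues Y' N := by
  intro h k _ N hN Y g hsep hft hqc hred hdim2 hdimN ν hν hνΦ
  haveI := hft
  haveI := hqc
  haveI := hred
  haveI : IsNoetherian Y := Scheme.isNoetherian_of_finiteType_over_field g
  have hexc : Scheme.IsExcellent Y :=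
    Scheme.isExcellent_of_locallyOfFiniteType Stacks07QW_field_holds g
  -- the level-`2` `ν`-elimination data of `Y` (hypothesis), raised to level `N`
  have h2 := h Y hexc (by exact_mod_cast hdim2)
  obtain ⟨s, hover, hmono, hkill⟩ := nuEliminationAt_of_two hdim2 h2 N hN ν hν hνΦ
  -- package the blow-up sequence
  obtain ⟨hprop, hsred, hsdim, hiso, hdense⟩ :=
    stub_centreSeq_package Y 2 hdim2 (Scheme.hsStratum Y N ν) s hover
  exact ⟨s.top, s.comp, hprop, hsred, hsdim, topologicalKrullDim_top_le s hdimN, hiso, hdense,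
    hmono, hkill⟩

end Summit.ResolutionOfSingularities.ResolutionOfSingularities.Theorems.SigmaMaxModifications.Sketch

end
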